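import Literature.Analysis.Calculus.SphereSpectralShell
import Literature.Analysis.Calculus.HarmonicPolynomialLaplacian
import HarnessLib

/-!
# The spherical Laplacian on homogeneous polynomials: eigenvalues `k(k+n−2)`

Analysis support file (everything proved; no definitions, no named facts) for the
spherical-harmonics route to the sharp Poincaré inequality on spheres (A. Waldron, Invent.
math. 217 (2019), Lemma 3.5): on `EuclideanSpace ℝ (Fin n)` with its standard frame, for a
homogeneous polynomial `p` of degree `K`,

* `fderiv_fderiv_toFun_self_self` — second Euler identity `D²p(x)(x,x) = K(K−1) p(x)`;
* `sphLaplacian_toFun_of_isHomogeneous` — **Euler's formula for the spherical Laplacian**: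
  `T p (x) = ‖x‖² Δp(x) − K(K+n−2) p(x)` everywhere (`T = ½∑∂_{L_{ij}}²`, `SphereSpectralShell`);
* `eq_zero_of_isHomogeneous_of_forall_sphere` — a homogeneous polynomial vanishing on the unit
  sphere is zero;
* `eigenvalue_sphLaplacian_of_isHomogeneous` — **the spectrum**: if `T p = −λ p` on the unit
  sphere and `p ≠ 0`, then `λ = k(k+n−2)` for some `k ≤ K`; in particular
  (`eigenvalue_zero_or_ge`) `λ = 0 ∨ λ ≥ n − 1`.

References: (spherical harmonics) [folklore]; A. Waldron, Invent. math. 217 (2019), Lemma 3.5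
[Waldron2019].
-/

noncomputable section

open scoped BigOperators RealInnerProductSpace
open MvPolynomial

namespace Literature.Analysis.Calculus

namespace MvPoly

variable {n : ℕ}

/-- Evaluation of a difference. [folklore] -/
@[simp] theorem toFun_sub (p q : MvPolynomial (Fin n) ℝ) (x : EuclideanSpace ℝ (Fin n)) :
    toFun (p - q) x = toFun p x - toFun q x := by simp [toFun]

/-- **Second Euler identity**: `D²p(x)(x, x) = K(K−1) p(x)` for `p` homogeneous of degree `K`.
[folklore] -/
theorem fderiv_fderiv_toFun_self_self {p : MvPolynomial (Fin n) ℝ} {K : ℕ}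
    (hp : p.IsHomogeneous K) (x : EuclideanSpace ℝ (Fin n)) :
    fderiv ℝ (fderiv ℝ (toFun p)) x x x = (K : ℝ) * (K - 1) * toFun p x := by
  have h2c : ContDiff ℝ 2 (toFun p) := contDiff_toFun p
  have hc : DifferentiableAt ℝ (fderiv ℝ (toFun p)) x :=
    (h2c.fderiv_right (m := 1) (by norm_num)).differentiable (by norm_num) x
  -- `g(y) = Dp(y) y = K p(y)`
  have hg : (fun y => fderiv ℝ (toFun p) y y) = fun y => (K : ℝ) * toFun p y :=
    funext fun y => fderiv_toFun_self_of_isHomogeneous hp y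
  have h1 : fderiv ℝ (fun y => fderiv ℝ (toFun p) y y) x x =
      fderiv ℝ (fderiv ℝ (toFun p)) x x x + fderiv ℝ (toFun p) x x := by
    rw [fderiv_clm_apply (u := fun y => y) hc differentiableAt_id]
    simp [add_comm]
  have h2 : fderiv ℝ (fun y => fderiv ℝ (toFun p) y y) x x = (K : ℝ) * ((K : ℝ) * toFun p x) := by
    rw [hg, fderiv_const_mul ((differentiable_toFun p) x)]
    simp [fderiv_toFun_self_of_isHomogeneous hp x]
  rw [fderiv_toFun_self_of_isHomogeneous hp x] at h1
  linarith [h1.symm.trans h2]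

/-- `ρ` evaluates to the squared norm. [folklore] -/
theorem toFun_rho (x : EuclideanSpace ℝ (Fin n)) : toFun rho x = ‖x‖ ^ 2 := by
  rw [EuclideanSpace.norm_sq_eq]
  simp [rho, toFun, map_sum, Real.norm_eq_abs, sq_abs]

/-- `ρ · q` of a homogeneous `q` of degree `K − 2` is homogeneous of degree `K` when `2 ≤ K`, and
`ρ · Δp` is homogeneous of degree `K` for every homogeneous `p` of degree `K`. [folklore] -/
theorem isHomogeneous_rho_mul_lap {p : MvPolynomial (Fin n) ℝ} {K : ℕ} (hp : p.IsHomogeneous K) :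
    (rho * lap p).IsHomogeneous K := by
  by_cases hK : 2 ≤ K
  · have h := isHomogeneous_rho.mul (isHomogeneous_lap hp)
    rwa [show 2 + (K - 2) = K by omega] at h
  · rw [lap_eq_zero_of_isHomogeneous_le_one hp (by omega), mul_zero]
    exact isHomogeneous_zero _ _ _

/-- **Euler's formula for the spherical Laplacian of a homogeneous polynomial**:
`T p (x) = ‖x‖² Δp(x) − K(K+n−2) p(x)` at every point, for the standard frame of
`EuclideanSpace ℝ (Fin n)`. [folklore] -/
theorem sphLaplacian_toFun_of_isHomogeneous {p : MvPolynomial (Fin n) ℝ} {K : ℕ}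
    (hp : p.IsHomogeneous K) (x : EuclideanSpace ℝ (Fin n)) :
    sphLaplacian (EuclideanSpace.basisFun (Fin n) ℝ) (toFun p) x =
      toFun (rho * lap p) x - (K : ℝ) * (K + n - 2) * toFun p x := by
  classical
  have h2c : ContDiff ℝ 2 (toFun p) := contDiff_toFun p
  have hc : DifferentiableAt ℝ (fderiv ℝ (toFun p)) x :=
    (h2c.fderiv_right (m := 1) (by norm_num)).differentiable (by norm_num) x
  unfold sphLaplacian angDeriv
  rw [sum_sum_fderiv_fderiv_angularField (EuclideanSpace.basisFun (Fin n) ℝ) hc]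
  simp only [EuclideanSpace.basisFun_apply, Fintype.card_fin]
  rw [laplacian_toFun, fderiv_fderiv_toFun_self_self hp, fderiv_toFun_self_of_isHomogeneous hp,
    toFun_mul, toFun_rho]
  simp only [lap]
  ring

/-- **A homogeneous polynomial vanishing on the unit sphere is zero** (`n ≥ 1`). [folklore] -/
theorem eq_zero_of_isHomogeneous_of_forall_sphere (hn : 0 < n) {p : MvPolynomial (Fin n) ℝ}
    {K : ℕ} (hp : p.IsHomogeneous K)
    (h : ∀ x : EuclideanSpace ℝ (Fin n), ‖x‖ = 1 → toFun p x = 0) : p = 0 := by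
  -- first, `toFun p` vanishes identically
  have hall : ∀ x : EuclideanSpace ℝ (Fin n), toFun p x = 0 := by
    intro x
    by_cases hx : x = 0
    · subst hx
      by_cases hK : K = 0
      · -- a constant: evaluate at a unit vector
        subst hK
        set e : EuclideanSpace ℝ (Fin n) := EuclideanSpace.single ⟨0, hn⟩ 1 with he_def
        have he : ‖e‖ = 1 := by rw [he_def, PiLp.norm_single, norm_one]
        have h1 := toFun_smul_of_isHomogeneous hp 0 e
        rw [zero_smul, pow_zero, one_mul] at h1
        rw [h1]; exact h e he
      · have h1 := toFun_smul_of_isHomogeneous hp 0 (0 : EuclideanSpace ℝ (Fin n))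
        rw [zero_smul, zero_pow hK, zero_mul] at h1
        exact h1
    · have hnx : ‖x‖ ≠ 0 := norm_ne_zero_iff.2 hx
      have h1 := toFun_smul_of_isHomogeneous hp ‖x‖ (‖x‖⁻¹ • x)
      rw [smul_smul, mul_inv_cancel₀ hnx, one_smul] at h1
      rw [h1, h _ (by rw [norm_smul, norm_inv, norm_norm, inv_mul_cancel₀ hnx]), mul_zero]
  haveI : Nonempty (Fin n) := ⟨⟨0, hn⟩⟩
  refine MvPolynomial.funext fun y => ?_
  have := hall (WithLp.toLp 2 y)
  simpa [toFun] using this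

/-- **The spectrum of the spherical Laplacian on homogeneous polynomials.** If `p ≠ 0` is
homogeneous of degree `K` on `ℝⁿ` (`n ≥ 1`) and `T p = −λ p` on the unit sphere, then
`λ = k(k+n−2)` for some `k ≤ K`. [folklore] -/
theorem eigenvalue_sphLaplacian_of_isHomogeneous (hn : 0 < n) {p : MvPolynomial (Fin n) ℝ} {K : ℕ}
    (hp : p.IsHomogeneous K) (hp0 : p ≠ 0) {lam : ℝ}
    (heig : ∀ x : EuclideanSpace ℝ (Fin n), ‖x‖ = 1 →
      sphLaplacian (EuclideanSpace.basisFun (Fin n) ℝ) (toFun p) x = -lam * toFun p x) :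
    ∃ k : ℕ, k ≤ K ∧ lam = (k : ℝ) * (k + n - 2) := by
  set c₀ : ℝ := (K : ℝ) * (K + n - 2) - lam with hc₀
  -- the homogeneous polynomial `ρ Δp − c₀ p` vanishes on the sphere, hence is zero
  have hw : (rho * lap p - C c₀ * p).IsHomogeneous K :=
    (isHomogeneous_rho_mul_lap hp).sub (by simpa using (isHomogeneous_C _ c₀).mul hp)
  have hw0 : rho * lap p - C c₀ * p = 0 := by
    refine eq_zero_of_isHomogeneous_of_forall_sphere hn hw fun x hx => ?_
    have h1 := sphLaplacian_toFun_of_isHomogeneous hp x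
    rw [heig x hx] at h1
    rw [toFun_sub, toFun_mul, toFun_mul, toFun_C, hc₀]
    rw [toFun_mul] at h1
    linarith
  have hrel : rho * lap p = C c₀ * p := sub_eq_zero.1 hw0
  obtain ⟨k, hk, hck⟩ := eigenvalue_of_rho_lap_eq_smul hp hp0 hrel
  exact ⟨k, hk, by rw [hc₀] at hck; linarith⟩

/-- Consequently the eigenvalue is `0` or at least `n − 1`. [folklore] -/
theorem eigenvalue_zero_or_ge (hn : 0 < n) {p : MvPolynomial (Fin n) ℝ} {K : ℕ}
    (hp : p.IsHomogeneous K) (hp0 : p ≠ 0) {lam : ℝ}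
    (heig : ∀ x : EuclideanSpace ℝ (Fin n), ‖x‖ = 1 →
      sphLaplacian (EuclideanSpace.basisFun (Fin n) ℝ) (toFun p) x = -lam * toFun p x) :
    lam = 0 ∨ (n : ℝ) - 1 ≤ lam := by
  obtain ⟨k, -, rfl⟩ := eigenvalue_sphLaplacian_of_isHomogeneous hn hp hp0 heig
  rcases Nat.eq_zero_or_pos k with hk | hk
  · left; simp [hk]
  · right
    have hk1 : (1 : ℝ) ≤ k := by exact_mod_cast hk
    have hn1 : (1 : ℝ) ≤ n := by exact_mod_cast hn
    nlinarith

end MvPoly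

end Literature.Analysis.Calculus
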